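import Summits.HodgeConjecture.HodgeConjecture.Theorems.Ring2WeilCoverageCMFieldAllPrimes
import Summits.HodgeConjecture.HodgeConjecture.Theorems.Ring2WeilCoverageCMFieldTablesA
import HarnessLib

/-!
# Weil-type components over quartic CM fields, IX (part I): the SPLIT side of `ℚ(ζ₅)` for a variable prime
# `ℓ ≡ 1 (mod 5)` — a four-variable Thue box, the norm form of `ℚ(ζ₅)` as a sum of squares, and the peeling lemmas

research route conditional on HC_CM; not a corollary; Q11.4-sentence-2 already refuted in dim ≥ 3. Cell
`pub-hodge-ring2`, seat `ring2-b03` (gen 51). Parts A–H leave exactly one congruence class of the seven census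
tables undecided for variable `ℓ` on a Galois field: the SPLIT side `ℓ ≡ 1 (mod 5)` of `E = ℚ(ζ₅)` (`F = ℚ(√5)`,
Deligne's `R = S² + 5S + 5`, `σ = η² = -(5+√5)/2`), where a norm witness needs the arithmetic of the QUARTIC field
(`Nm_{E/F}` takes rational values only on `F`). This part and part J prove **`[ℓ] = [1]` for every prime
`ℓ ≡ 1 (mod 5)`**, hence the complete classification `[ℓ] ≠ [1] ⟺ ℓ ≢ 1 (mod 5), ℓ ≠ 5`. The argument (all in the
kernel, no named fact):

1. (§1, FOUR-VARIABLE THUE) pigeonhole on the `(m+1)⁴ > ℓ` values of a linear form in `𝔽_ℓ` gives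
   `z = (c₀ + c₁φ) + (c₂ + c₃φ)η ≠ 0` (`φ = -2 - σ` the golden unit) with `|cᵢ| ≤ m`, `m⁴ < ℓ`, and `z ≡ 0` at a
   degree-one place of `E` over `ℓ` (`η ↦ e`, `e⁴ + 5e² + 5 = 0`; such `e = ζ - ζ⁻¹` exists iff `5 ∣ ℓ - 1`, part J);
2. (§2) `Q(c) := Nm_{E/ℚ}(z)` is DIVISIBLE by `ℓ` (an explicit identity `Q = L·M + N·(e⁴ + 5e² + 5)`), is the SUM OF
   SQUARES `Q = P₀² + 5(P₁² + P₂² + P₃²)` (`P₀ = c₀² + c₀c₁ - c₁²`, `P₁ = c₁c₂ - c₀c₃`, `P₂ = c₁c₃ - c₀c₃ - c₀c₂`,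
   `P₃ = c₃² - c₂c₃ - c₂²` — the Lagrange identity for `Nm_{F/ℚ}(a² + b² + (φb)²)`, `-σ = 1 + φ²`), vanishes only at
   `c = 0` (`√5 ∉ ℚ`), and is `≤ 119·m⁴ < 119ℓ`; and `Q = Nm_{E/F}(z·τz)` for the generator `τ : η ↦ (-3-σ)η`,
   `σ ↦ -5-σ` of `Gal(E/ℚ) ≅ C₄` — an explicit integer norm witness `(A, B, C, D)` with `A² - 5B² + 10CD - 25D² = Q`,
   `2AB - 5B² - C² + 10CD - 20D² = 0`, so `[Q] = [kℓ] = [1]` with `1 ≤ k ≤ 118`;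
3. (§3, PEELING) from `[kℓ] = [1]`: odd primes `q ≢ 0, 1 (mod 5)` divide `k` to an even power (else part A's
   `[q·w] ≠ [1]`), `[5] = [1]`, primes `p ≡ 1 (mod 5)` below `119` are `11, 31, 41, 61, 71, 101` (norm witnesses,
   part J / gen 49), and a single left-over factor `2` would give `[2ℓ] = [1]`, `2ℓ ≡ 2 (mod 5)`, against gen 47's
   `(√5)`-adic residue theorem — so `[ℓ] = [1]`.

No named fact, no definition, no `sorry`; nothing about the Hodge conjecture is asserted.
References: [Deligne1982HodgeCycles] §4 p. 30 (1), Cor. 4.2, Lemma 4.6; [Landherr1936HermitianForms]. -/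

noncomputable section

set_option linter.dupNamespace false

open Polynomial

namespace Summit.HodgeConjecture.HodgeConjecture.Ring2.WeilCoverageCM

open Literature.AlgebraicGeometry.Deligne1982
open Literature.AlgebraicGeometry.HodgeTheory (splitDiscriminantClassCM)

/-! ### §1 A four-variable Thue box -/

section Box

variable {ℓ : ℕ} [hℓ : Fact ℓ.Prime]

/-- **Four-variable Thue box.** For `f, e ∈ 𝔽_ℓ` there are integers `c₀, …, c₃`, not all zero, with `|cᵢ| ≤ m`,
`m⁴ < ℓ`, and `c₀ + c₁f + (c₂ + c₃f)e = 0` in `𝔽_ℓ` (pigeonhole on the `(m+1)⁴ > ℓ` values of the form on the box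
`[0, m]⁴`, `m = ⌊ℓ^{1/4}⌋`; `m⁴ ≠ ℓ` since `ℓ` is prime). [folklore] -/
theorem box_four (f e : ZMod ℓ) :
    ∃ m : ℕ, m ^ 4 < ℓ ∧ ∃ c₀ c₁ c₂ c₃ : ℤ, (c₀ ≠ 0 ∨ c₁ ≠ 0 ∨ c₂ ≠ 0 ∨ c₃ ≠ 0) ∧
      |c₀| ≤ m ∧ |c₁| ≤ m ∧ |c₂| ≤ m ∧ |c₃| ≤ m ∧
      (c₀ : ZMod ℓ) + c₁ * f + (c₂ + c₃ * f) * e = 0 := by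
  classical
  obtain ⟨m, hm⟩ : ∃ m, m = Nat.sqrt (Nat.sqrt ℓ) := ⟨_, rfl⟩
  have h1 : m ^ 2 ≤ Nat.sqrt ℓ := by rw [hm]; exact Nat.sqrt_le' _
  have h2 : Nat.sqrt ℓ < (m + 1) ^ 2 := by rw [hm]; exact Nat.lt_succ_sqrt' _
  have h3 : (Nat.sqrt ℓ) ^ 2 ≤ ℓ := Nat.sqrt_le' ℓ
  have h4 : ℓ < (Nat.sqrt ℓ + 1) ^ 2 := Nat.lt_succ_sqrt' ℓ
  have hm4le : m ^ 4 ≤ ℓ :=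
    calc m ^ 4 = (m ^ 2) ^ 2 := by ring
      _ ≤ (Nat.sqrt ℓ) ^ 2 := Nat.pow_le_pow_left h1 2
      _ ≤ ℓ := h3
  have hm4 : m ^ 4 < ℓ := by
    rcases hm4le.lt_or_eq with h | h
    · exact h
    · exfalso
      have hdvd : m ∣ ℓ := ⟨m ^ 3, by rw [← h]; ring⟩
      have h1' := hℓ.out.one_lt
      rcases (Nat.dvd_prime hℓ.out).1 hdvd with h5 | h5
      · rw [h5] at h; omega
      · rw [h5] at h
        have h8 : 2 ^ 3 ≤ ℓ ^ 3 := Nat.pow_le_pow_left hℓ.out.two_le 3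
        have : ℓ * 8 ≤ ℓ ^ 4 := by
          calc ℓ * 8 = ℓ * 2 ^ 3 := by norm_num
            _ ≤ ℓ * ℓ ^ 3 := Nat.mul_le_mul_left ℓ h8
            _ = ℓ ^ 4 := by ring
        rw [h] at this
        omega
  have hbox : ℓ < (m + 1) ^ 4 :=
    calc ℓ < (Nat.sqrt ℓ + 1) ^ 2 := h4
      _ ≤ ((m + 1) ^ 2) ^ 2 := Nat.pow_le_pow_left h2 2
      _ = (m + 1) ^ 4 := by ring
  let S : Finset ((ℕ × ℕ) × (ℕ × ℕ)) :=
    (Finset.range (m + 1) ×ˢ Finset.range (m + 1)) ×ˢ (Finset.range (m + 1) ×ˢ Finset.range (m + 1))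
  have hS : S.card = (m + 1) ^ 4 := by simp [S, Finset.card_product]; ring
  have hlt : (Finset.univ : Finset (ZMod ℓ)).card < S.card := by
    rw [Finset.card_univ, ZMod.card, hS]; exact hbox
  obtain ⟨a, ha, b, hb, hne, heq⟩ := Finset.exists_ne_map_eq_of_card_lt_of_maps_to hlt
    (f := fun u : (ℕ × ℕ) × (ℕ × ℕ) => ((u.1.1 : ZMod ℓ) + u.1.2 * f + (u.2.1 + u.2.2 * f) * e))
    (fun _ _ => Finset.mem_coe.2 (Finset.mem_univ _))
  simp only [S, Finset.mem_product, Finset.mem_range] at ha hb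
  refine ⟨m, hm4, (a.1.1 : ℤ) - b.1.1, (a.1.2 : ℤ) - b.1.2, (a.2.1 : ℤ) - b.2.1, (a.2.2 : ℤ) - b.2.2,
    ?_, ?_, ?_, ?_, ?_, ?_⟩
  · by_contra h
    simp only [not_or, not_not] at h
    obtain ⟨h1, h2, h3, h4⟩ := h
    exact hne (Prod.ext (Prod.ext (by omega) (by omega)) (Prod.ext (by omega) (by omega)))
  · exact abs_le.2 ⟨by omega, by omega⟩
  · exact abs_le.2 ⟨by omega, by omega⟩
  · exact abs_le.2 ⟨by omega, by omega⟩
  · exact abs_le.2 ⟨by omega, by omega⟩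
  · push_cast
    linear_combination heq

end Box

/-! ### §2 The norm form of `ℚ(ζ₅)` on `z = (c₀ + c₁φ) + (c₂ + c₃φ)η`: divisibility, sum of squares, bound,
nonvanishing -/

section NormForm

/-- **Divisibility.** If `e⁴ + 5e² + 5 = 0` in `𝔽_ℓ` (a degree-one place of `E = ℚ(ζ₅)` over `ℓ`: `η ↦ e`, `σ ↦ e²`,
`φ ↦ -2 - e²`) and `z = (c₀ + c₁φ) + (c₂ + c₃φ)η ↦ 0`, then `ℓ ∣ Nm_{E/ℚ}(z) = P₀² + 5(P₁² + P₂² + P₃²)` — by the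
explicit identity `Nm(z) = z·M + N·(e⁴ + 5e² + 5)` in `ℤ[c][e]`. [folklore] -/
theorem zeta5_normForm_zmod_eq_zero {ℓ : ℕ} (e : ZMod ℓ) (he : e ^ 4 + 5 * e ^ 2 + 5 = 0) (c₀ c₁ c₂ c₃ : ℤ)
    (hL : ((c₀ : ZMod ℓ) - 2 * c₁) + (-(c₁ : ZMod ℓ)) * e ^ 2 + (((c₂ : ZMod ℓ) - 2 * c₃) + (-(c₃ : ZMod ℓ)) * e ^ 2) * e = 0) :
    ((((c₀ ^ 2 + c₀ * c₁ - c₁ ^ 2) ^ 2 + 5 * ((c₁ * c₂ - c₀ * c₃) ^ 2 + (c₁ * c₃ - c₀ * c₃ - c₀ * c₂) ^ 2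
        + (c₃ ^ 2 - c₂ * c₃ - c₂ ^ 2) ^ 2) : ℤ)) : ZMod ℓ) = 0 := by
  push_cast
  -- `X, Y` = the coordinates of `Nm_{E/F}(z) = X + Yσ`; `T = X - 5Y - Ye²`; `G` the reduction polynomial
  linear_combination
    ((((c₀ : ZMod ℓ) - 2 * c₁) + (-(c₁ : ZMod ℓ)) * e ^ 2 - (((c₂ : ZMod ℓ) - 2 * c₃) + (-(c₃ : ZMod ℓ)) * e ^ 2) * e) *
      (((-5) * (c₃ : ZMod ℓ) ^ 2 + (-10) * c₂ * c₃ + (-1) * c₁ ^ 2 + (-4) * c₀ * c₁ + c₀ ^ 2)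
        - 5 * ((-4) * (c₃ : ZMod ℓ) ^ 2 + (-6) * c₂ * c₃ + (-1) * c₂ ^ 2 + (-1) * c₁ ^ 2 + (-2) * c₀ * c₁)
        - ((-4) * (c₃ : ZMod ℓ) ^ 2 + (-6) * c₂ * c₃ + (-1) * c₂ ^ 2 + (-1) * c₁ ^ 2 + (-2) * c₀ * c₁) * e ^ 2)) * hL
    + (((-4) * (c₃ : ZMod ℓ) ^ 2 + (-6) * c₂ * c₃ + (-1) * c₂ ^ 2 + (-1) * c₁ ^ 2 + (-2) * c₀ * c₁) ^ 2
        - ((c₁ : ZMod ℓ) ^ 2 + 2 * c₂ * c₃ + c₃ ^ 2 - c₃ ^ 2 * e ^ 2) *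
          (((-5) * (c₃ : ZMod ℓ) ^ 2 + (-10) * c₂ * c₃ + (-1) * c₁ ^ 2 + (-4) * c₀ * c₁ + c₀ ^ 2)
            - 5 * ((-4) * (c₃ : ZMod ℓ) ^ 2 + (-6) * c₂ * c₃ + (-1) * c₂ ^ 2 + (-1) * c₁ ^ 2 + (-2) * c₀ * c₁)
            - ((-4) * (c₃ : ZMod ℓ) ^ 2 + (-6) * c₂ * c₃ + (-1) * c₂ ^ 2 + (-1) * c₁ ^ 2 + (-2) * c₀ * c₁) * e ^ 2)) * he

/-- **Bound.** `|cᵢ| ≤ m ⇒ P₀² + 5(P₁² + P₂² + P₃²) ≤ 119·m⁴` (`|P₀|, |P₂|, |P₃| ≤ 3m²`, `|P₁| ≤ 2m²`). [folklore] -/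
theorem zeta5_normForm_le (m : ℕ) (c₀ c₁ c₂ c₃ : ℤ) (h₀ : |c₀| ≤ m) (h₁ : |c₁| ≤ m) (h₂ : |c₂| ≤ m)
    (h₃ : |c₃| ≤ m) :
    (c₀ ^ 2 + c₀ * c₁ - c₁ ^ 2) ^ 2 + 5 * ((c₁ * c₂ - c₀ * c₃) ^ 2 + (c₁ * c₃ - c₀ * c₃ - c₀ * c₂) ^ 2
        + (c₃ ^ 2 - c₂ * c₃ - c₂ ^ 2) ^ 2) ≤ 119 * (m : ℤ) ^ 4 := by
  obtain ⟨h₀l, h₀r⟩ := abs_le.1 h₀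
  obtain ⟨h₁l, h₁r⟩ := abs_le.1 h₁
  obtain ⟨h₂l, h₂r⟩ := abs_le.1 h₂
  obtain ⟨h₃l, h₃r⟩ := abs_le.1 h₃
  have s₀ : c₀ ^ 2 ≤ (m : ℤ) ^ 2 := sq_le_sq' h₀l h₀r
  have s₁ : c₁ ^ 2 ≤ (m : ℤ) ^ 2 := sq_le_sq' h₁l h₁r
  have s₂ : c₂ ^ 2 ≤ (m : ℤ) ^ 2 := sq_le_sq' h₂l h₂r
  have s₃ : c₃ ^ 2 ≤ (m : ℤ) ^ 2 := sq_le_sq' h₃l h₃r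
  have hm2 : ((m : ℤ)) ^ 2 = (m : ℤ) * m := sq _
  have p₀₁ : |c₀ * c₁| ≤ (m : ℤ) ^ 2 := by
    rw [abs_mul, hm2]; exact mul_le_mul h₀ h₁ (abs_nonneg _) (by positivity)
  have p₀₂ : |c₀ * c₂| ≤ (m : ℤ) ^ 2 := by
    rw [abs_mul, hm2]; exact mul_le_mul h₀ h₂ (abs_nonneg _) (by positivity)
  have p₀₃ : |c₀ * c₃| ≤ (m : ℤ) ^ 2 := by
    rw [abs_mul, hm2]; exact mul_le_mul h₀ h₃ (abs_nonneg _) (by positivity)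
  have p₁₂ : |c₁ * c₂| ≤ (m : ℤ) ^ 2 := by
    rw [abs_mul, hm2]; exact mul_le_mul h₁ h₂ (abs_nonneg _) (by positivity)
  have p₁₃ : |c₁ * c₃| ≤ (m : ℤ) ^ 2 := by
    rw [abs_mul, hm2]; exact mul_le_mul h₁ h₃ (abs_nonneg _) (by positivity)
  have p₂₃ : |c₂ * c₃| ≤ (m : ℤ) ^ 2 := by
    rw [abs_mul, hm2]; exact mul_le_mul h₂ h₃ (abs_nonneg _) (by positivity)
  obtain ⟨l₀₁, r₀₁⟩ := abs_le.1 p₀₁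
  obtain ⟨l₀₂, r₀₂⟩ := abs_le.1 p₀₂
  obtain ⟨l₀₃, r₀₃⟩ := abs_le.1 p₀₃
  obtain ⟨l₁₂, r₁₂⟩ := abs_le.1 p₁₂
  obtain ⟨l₁₃, r₁₃⟩ := abs_le.1 p₁₃
  obtain ⟨l₂₃, r₂₃⟩ := abs_le.1 p₂₃
  have m0 : (0 : ℤ) ≤ (m : ℤ) ^ 2 := sq_nonneg _
  have q₀ : |c₀ ^ 2 + c₀ * c₁ - c₁ ^ 2| ≤ 3 * (m : ℤ) ^ 2 :=
    abs_le.2 ⟨by linarith [sq_nonneg c₀, sq_nonneg c₁], by linarith [sq_nonneg c₀, sq_nonneg c₁]⟩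
  have q₁ : |c₁ * c₂ - c₀ * c₃| ≤ 2 * (m : ℤ) ^ 2 := abs_le.2 ⟨by linarith, by linarith⟩
  have q₂ : |c₁ * c₃ - c₀ * c₃ - c₀ * c₂| ≤ 3 * (m : ℤ) ^ 2 := abs_le.2 ⟨by linarith, by linarith⟩
  have q₃ : |c₃ ^ 2 - c₂ * c₃ - c₂ ^ 2| ≤ 3 * (m : ℤ) ^ 2 :=
    abs_le.2 ⟨by linarith [sq_nonneg c₂, sq_nonneg c₃], by linarith [sq_nonneg c₂, sq_nonneg c₃]⟩
  have r₀ := sq_le_sq' (abs_le.1 q₀).1 (abs_le.1 q₀).2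
  have r₁ := sq_le_sq' (abs_le.1 q₁).1 (abs_le.1 q₁).2
  have r₂ := sq_le_sq' (abs_le.1 q₂).1 (abs_le.1 q₂).2
  have r₃ := sq_le_sq' (abs_le.1 q₃).1 (abs_le.1 q₃).2
  nlinarith [r₀, r₁, r₂, r₃]

/-- **Nonvanishing.** `P₀² + 5(P₁² + P₂² + P₃²) = 0` forces `c = 0`: `P₀ = c₀² + c₀c₁ - c₁² = 0` gives
`(2c₀ + c₁)² = 5c₁²`, so `c₁ = 0 = c₀` (`√5 ∉ ℚ`), and likewise `P₃ = 0` gives `c₂ = c₃ = 0`. [folklore] -/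
theorem zeta5_normForm_ne_zero (c₀ c₁ c₂ c₃ : ℤ) (hne : c₀ ≠ 0 ∨ c₁ ≠ 0 ∨ c₂ ≠ 0 ∨ c₃ ≠ 0) :
    (c₀ ^ 2 + c₀ * c₁ - c₁ ^ 2) ^ 2 + 5 * ((c₁ * c₂ - c₀ * c₃) ^ 2 + (c₁ * c₃ - c₀ * c₃ - c₀ * c₂) ^ 2
        + (c₃ ^ 2 - c₂ * c₃ - c₂ ^ 2) ^ 2) ≠ 0 := by
  intro h
  have hP₀ : c₀ ^ 2 + c₀ * c₁ - c₁ ^ 2 = 0 := by nlinarith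
  have hP₃ : c₃ ^ 2 - c₂ * c₃ - c₂ ^ 2 = 0 := by nlinarith
  -- `(2c₀ + c₁)² = 5c₁²` and `(2c₃ - c₂)² = 5c₂²`
  have e₁ : (2 * c₀ + c₁) ^ 2 = 5 * c₁ ^ 2 := by linear_combination 4 * hP₀
  have e₂ : (2 * c₃ - c₂) ^ 2 = 5 * c₂ ^ 2 := by linear_combination 4 * hP₃
  have hc₁ : c₁ = 0 := by
    by_contra h1
    have e₁' := congrArg (Int.cast : ℤ → ℚ) e₁
    push_cast at e₁'
    exact rat_sq_ne_prime_mul_sq (by norm_num : Nat.Prime 5) (m := (c₁ : ℚ)) (by exact_mod_cast h1)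
      (2 * (c₀ : ℚ) + c₁) (by rw [e₁']; norm_num)
  have hc₂ : c₂ = 0 := by
    by_contra h2
    have e₂' := congrArg (Int.cast : ℤ → ℚ) e₂
    push_cast at e₂'
    exact rat_sq_ne_prime_mul_sq (by norm_num : Nat.Prime 5) (m := (c₂ : ℚ)) (by exact_mod_cast h2)
      (2 * (c₃ : ℚ) - c₂) (by rw [e₂']; norm_num)
  rw [hc₁] at e₁
  rw [hc₂] at e₂
  have hc₀ : c₀ = 0 := by nlinarith
  have hc₃ : c₃ = 0 := by nlinarith
  rcases hne with h | h | h | h <;> contradiction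

end NormForm

/-! ### §3 Peeling tools in `F^×/Nm_{E/F}(E^×)` (any census field) -/

section Peel

variable {R : Polynomial ℤ} [Fact (Irreducible (realPolyQ R))] [Fact (Irreducible (cmPolyQ R))]

omit [Fact (Irreducible (cmPolyQ R))] in
/-- `[a·b] = [1]` and `[a] = [1]` give `[b] = [1]` (classes of positive integers). [folklore] -/
theorem natCast_split_of_mul_of_left (a b : ℕ) (ha : 1 ≤ a)
    (hsa : ∀ v : (realField R)ˣ, (v : realField R) = a →
      (QuotientGroup.mk v : cmNormResidueGroup R) = splitDiscriminantClassCM R 2)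
    (hsab : ∀ v : (realField R)ˣ, (v : realField R) = ((a * b : ℕ) : realField R) →
      (QuotientGroup.mk v : cmNormResidueGroup R) = splitDiscriminantClassCM R 2)
    (v : (realField R)ˣ) (hv : (v : realField R) = b) :
    (QuotientGroup.mk v : cmNormResidueGroup R) = splitDiscriminantClassCM R 2 := by
  set ua : (realField R)ˣ := Units.mk0 (a : realField R) (natCast_ne_zero_realField a ha) with hua
  have h1 := hsa ua (Units.val_mk0 _)
  have h2 := hsab (ua * v) (by rw [Units.val_mul, hua, Units.val_mk0, hv]; push_cast; ring)
  rw [splitDiscriminantClassCM_two_eq_one, QuotientGroup.eq_one_iff] at h1 h2 ⊢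
  have : v = ua⁻¹ * (ua * v) := by group
  rw [this]
  exact mul_mem (inv_mem h1) h2

/-- `[a²·b] = [1]` gives `[b] = [1]` (squares are norms). [folklore] -/
theorem natCast_split_of_sq_mul (a b : ℕ) (ha : 1 ≤ a)
    (hsab : ∀ v : (realField R)ˣ, (v : realField R) = ((a * a * b : ℕ) : realField R) →
      (QuotientGroup.mk v : cmNormResidueGroup R) = splitDiscriminantClassCM R 2)
    (v : (realField R)ˣ) (hv : (v : realField R) = b) :
    (QuotientGroup.mk v : cmNormResidueGroup R) = splitDiscriminantClassCM R 2 := by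
  set ua : (realField R)ˣ := Units.mk0 (a : realField R) (natCast_ne_zero_realField a ha) with hua
  have h2 := hsab (v * ua ^ 2) (by
    rw [Units.val_mul, Units.val_pow_eq_pow_val, hua, Units.val_mk0, hv]; push_cast; ring)
  rw [mk_mul_sq_cmNormResidueGroup] at h2
  exact h2

end Peel

end Summit.HodgeConjecture.HodgeConjecture.Ring2.WeilCoverageCM

end
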